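import Mathlib

/-!
# Route «KPlusLogSqLaw» — parametric max-weight independent set on a path: THEOREM T, part 1 — the rectangle / alternating-sum count

HONEST FRAMING.  Helper toward the crux `WeakLifting` (item `stmt-ValiantsHypothesis-19561`, route `KPlusLogSqLaw`, cell `pub-symmetroid`,
seat val-sym-lift-p4 g20, 2026-08-29) on the line of its witness-plan stub `stub_tridiagonalSectorB` (tropical twin of the STATIC tridiagonal
sector = parametric maximum-weight independent set on a path).  First of two files putting the lineage's THEOREM T (val-sym-lift-p4 g14,
`HOME/val-sym-lift-p4/THEOREM-T.md`: «pair creations + annihilations ≤ 2n», the proved linear half of the ORDER QUESTION) in the kernel.  THIS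
FILE is the purely combinatorial heart, with the geometry abstracted into two hypotheses: `G p q t` = «index `t` is correct at the vertex of the
pair `(p, q)`», `S p q` = «`(p, q)` is a pair of the type being counted» (implying `p + q` odd); a TIP of the index window `[i, j]` is a pair
`p < q` of the window with `S p q` at whose vertex every other index of the window is correct.  If (U) every window has at most one tip and (B) for
fixed `i` the right ends `j ≤ n` of windows with a tip form an interval, then (`card_le_of_unique_tips`) the pairs `p < q ≤ n` with `S p q`
satisfying (M) «every index strictly between is correct», (L) «the maximal run of correct indices `p-1, p-2, …` has even length», (R) «the maximal
run of correct indices `q+1, q+2, …` inside `0..n` has even length» number AT MOST `n`: the windows whose tip is such a pair form a rectangle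
`(b⁻, p] × [q, b⁺)` of signed area `Σ (-1)^(i+j) = (-1)^(p+q)·[(L) ∧ (R)] = -[(L) ∧ (R)]` (`tipRow_altSum`, `tipCol_altSum`), and the total
signed area over the window grid is a sum of `n + 1` row sums in `{-1, 0, 1}` (`abs_altSum_convex_le`), the last one `0`.  The second file
(`…StaticPathMixedEvents`) discharges (U) and (B) for left tips of corridors of a labelled line arrangement and concludes «mixed events ≤ 2n».
Statements about finite alternating sums; nothing here asserts anything about `WeakLifting`, `TropicalB`, `KPlusLogSqLaw`, the stub in its
window, `MatrixDescartes` (stmt-ValiantsHypothesis-18050) or `VP ≠ VNP`.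
-/

set_option linter.dupNamespace false
set_option autoImplicit false

namespace Summit.ValiantsHypothesis.ValiantsHypothesis.Theorems.KPlusLogSqLaw

open Finset Classical

namespace StaticPathFold

/-! ## 1. Alternating sums over intervals -/

/-- the alternating sum `Σ (-1)^t` over the interval `[u, u + r]` is `(-1)^u` if `r` is even and `0` if `r` is odd. [folklore] -/
theorem altSum_Icc_eq (u r : ℕ) : ∑ t ∈ Icc u (u + r), (-1 : ℤ) ^ t = if Even r then (-1) ^ u else 0 := by
  induction r with
  | zero => simp
  | succ r ih =>
    have hu : u ≤ u + r + 1 := by omega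
    rw [← Nat.add_assoc, ← Finset.insert_Icc_right_eq_Icc_add_one hu, sum_insert (by simp), ih]
    rcases Nat.even_or_odd r with hr | hr
    · have hr1 : ¬ Even (r + 1) := by rw [Nat.even_add_one]; exact not_not.mpr hr
      rw [if_pos hr, if_neg hr1, pow_succ, pow_add, Even.neg_one_pow hr]; ring
    · have hr1 : Even (r + 1) := hr.add_one
      have hr0 : ¬ Even r := Nat.not_even_iff_odd.mpr hr
      rw [if_neg hr0, if_pos hr1, pow_succ, pow_add, Odd.neg_one_pow hr]; ring

/-- an alternating sum `Σ (-1)^t` over an interval of naturals has absolute value at most `1`. [folklore] -/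
theorem abs_altSum_Icc_le (u v : ℕ) : |∑ t ∈ Icc u v, (-1 : ℤ) ^ t| ≤ 1 := by
  rcases le_or_gt u v with h | h
  · obtain ⟨r, rfl⟩ := Nat.exists_eq_add_of_le h
    rw [altSum_Icc_eq]
    split_ifs
    · rw [abs_pow, abs_neg, abs_one, one_pow]
    · simp
  · rw [Icc_eq_empty_of_lt h, sum_empty]; simp

/-- an alternating sum `Σ (-1)^t` over an order-convex finite set of naturals has absolute value at most `1`. [folklore] -/
theorem abs_altSum_convex_le (J : Finset ℕ) (hJ : ∀ j₁ j₂ j₃, j₁ ≤ j₂ → j₂ ≤ j₃ → j₁ ∈ J → j₃ ∈ J → j₂ ∈ J) :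
    |∑ t ∈ J, (-1 : ℤ) ^ t| ≤ 1 := by
  rcases J.eq_empty_or_nonempty with h | h
  · rw [h, sum_empty]; simp
  · have hJ' : J = Icc (J.min' h) (J.max' h) := by
      ext j
      constructor
      · intro hj; rw [mem_Icc]; exact ⟨min'_le J j hj, le_max' J j hj⟩
      · intro hj; rw [mem_Icc] at hj; exact hJ _ _ _ hj.1 hj.2 (min'_mem J h) (max'_mem J h)
    rw [hJ']; exact abs_altSum_Icc_le _ _

/-! ## 2. The signed area of a rectangle of windows -/

/-- ROW SUM of a rectangle: the rows `i ≤ p` from which every index up to `p - 1` is good form the interval `[p - r₀, p]`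
(`r₀` = the maximal run), whose alternating sum is `(-1)^p` if `r₀` is even and `0` otherwise. [folklore] -/
theorem tipRow_altSum (G : ℕ → Prop) (n p : ℕ) (hp : p ≤ n) :
    ∑ i ∈ (range (n + 1)).filter (fun i => i ≤ p ∧ ∀ t, i ≤ t → t < p → G t), (-1 : ℤ) ^ i =
      if (∃ r, Even r ∧ r ≤ p ∧ (∀ t, p - r ≤ t → t < p → G t) ∧ (r = p ∨ ¬ G (p - r - 1))) then (-1) ^ p else 0 := by
  have hex : ∃ r, r = p ∨ ¬ G (p - r - 1) := ⟨p, Or.inl rfl⟩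
  set r₀ := Nat.find hex with hr₀
  have hspec : r₀ = p ∨ ¬ G (p - r₀ - 1) := Nat.find_spec hex
  have hr₀p : r₀ ≤ p := Nat.find_min' hex (Or.inl rfl)
  have hrun : ∀ t, p - r₀ ≤ t → t < p → G t := by
    intro t ht1 ht2
    have hlt : p - 1 - t < r₀ := by omega
    have := Nat.find_min hex hlt
    push Not at this
    have h2 := this.2
    rwa [show p - (p - 1 - t) - 1 = t by omega] at h2
  -- the row set is the interval
  have hset : (range (n + 1)).filter (fun i => i ≤ p ∧ ∀ t, i ≤ t → t < p → G t) = Icc (p - r₀) (p - r₀ + r₀) := by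
    rw [Nat.sub_add_cancel hr₀p]
    ext i
    simp only [mem_filter, mem_range, mem_Icc]
    constructor
    · rintro ⟨-, hip, hi⟩
      refine ⟨?_, hip⟩
      by_contra hlt
      push Not at hlt
      have hne : r₀ ≠ p := by omega
      have hbad : ¬ G (p - r₀ - 1) := hspec.resolve_left hne
      exact hbad (hi _ (by omega) (by omega))
    · rintro ⟨h1, h2⟩
      exact ⟨by omega, h2, fun t ht1 ht2 => hrun t (by omega) ht2⟩
  rw [hset, altSum_Icc_eq]
  -- the event condition (L) says exactly that `r₀` is even
  have hiff : (∃ r, Even r ∧ r ≤ p ∧ (∀ t, p - r ≤ t → t < p → G t) ∧ (r = p ∨ ¬ G (p - r - 1))) ↔ Even r₀ := by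
    constructor
    · rintro ⟨r, hre, hrp, hrrun, hrend⟩
      have h1 : r₀ ≤ r := Nat.find_min' hex hrend
      have h2 : r ≤ r₀ := by
        by_contra hlt
        push Not at hlt
        have hne : r₀ ≠ p := by omega
        exact (hspec.resolve_left hne) (hrrun _ (by omega) (by omega))
      exact (le_antisymm h1 h2) ▸ hre
    · intro he
      exact ⟨r₀, he, hr₀p, hrun, hspec⟩
  by_cases he : Even r₀
  · rw [if_pos he, if_pos (hiff.mpr he)]
    have : (-1 : ℤ) ^ p = (-1) ^ (p - r₀) * (-1) ^ r₀ := by rw [← pow_add, Nat.sub_add_cancel hr₀p]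
    rw [this, Even.neg_one_pow he, mul_one]
  · rw [if_neg he, if_neg (fun h => he (hiff.mp h))]

/-- COLUMN SUM of a rectangle: the columns `j ≥ q` (up to `n`) down to which every index after `q` is good form the interval
`[q, q + s₀]`, whose alternating sum is `(-1)^q` if `s₀` is even and `0` otherwise. [folklore] -/
theorem tipCol_altSum (G : ℕ → Prop) (n q : ℕ) (hq : q ≤ n) :
    ∑ j ∈ (range (n + 1)).filter (fun j => q ≤ j ∧ ∀ t, q < t → t ≤ j → G t), (-1 : ℤ) ^ j =
      if (∃ r, Even r ∧ q + r ≤ n ∧ (∀ t, q < t → t ≤ q + r → G t) ∧ (q + r = n ∨ ¬ G (q + r + 1))) then (-1) ^ q else 0 := by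
  have hex : ∃ s, q + s = n ∨ ¬ G (q + s + 1) := ⟨n - q, Or.inl (by omega)⟩
  set s₀ := Nat.find hex with hs₀
  have hspec : q + s₀ = n ∨ ¬ G (q + s₀ + 1) := Nat.find_spec hex
  have hs₀n : s₀ ≤ n - q := Nat.find_min' hex (Or.inl (by omega))
  have hrun : ∀ t, q < t → t ≤ q + s₀ → G t := by
    intro t ht1 ht2
    have hlt : t - q - 1 < s₀ := by omega
    have := Nat.find_min hex hlt
    push Not at this
    have h2 := this.2
    rwa [show q + (t - q - 1) + 1 = t by omega] at h2
  have hset : (range (n + 1)).filter (fun j => q ≤ j ∧ ∀ t, q < t → t ≤ j → G t) = Icc q (q + s₀) := by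
    ext j
    simp only [mem_filter, mem_range, mem_Icc]
    constructor
    · rintro ⟨hjn, hqj, hj⟩
      refine ⟨hqj, ?_⟩
      by_contra hlt
      push Not at hlt
      have hne : q + s₀ ≠ n := by omega
      have hbad : ¬ G (q + s₀ + 1) := hspec.resolve_left hne
      exact hbad (hj _ (by omega) (by omega))
    · rintro ⟨h1, h2⟩
      exact ⟨by omega, h1, fun t ht1 ht2 => hrun t ht1 (by omega)⟩
  rw [hset, altSum_Icc_eq]
  have hiff : (∃ r, Even r ∧ q + r ≤ n ∧ (∀ t, q < t → t ≤ q + r → G t) ∧ (q + r = n ∨ ¬ G (q + r + 1))) ↔ Even s₀ := by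
    constructor
    · rintro ⟨r, hre, hrn, hrrun, hrend⟩
      have h1 : s₀ ≤ r := Nat.find_min' hex hrend
      have h2 : r ≤ s₀ := by
        by_contra hlt
        push Not at hlt
        have hne : q + s₀ ≠ n := by omega
        exact (hspec.resolve_left hne) (hrrun _ (by omega) (by omega))
      exact (le_antisymm h1 h2) ▸ hre
    · intro he
      exact ⟨s₀, he, by omega, hrun, hspec⟩
  by_cases he : Even s₀
  · rw [if_pos he, if_pos (hiff.mpr he)]
  · rw [if_neg he, if_neg (fun h => he (hiff.mp h))]

/-! ## 3. The count -/

/-- THE COUNTING LEMMA (combinatorial heart of Theorem T).  `G p q t` = «line `t` is correct at the vertex of the pair `(p, q)`»,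
`S p q` = «`(p, q)` is a pair of the type being counted» (implying `p + q` odd).  A TIP of the window `[i, j]` is a pair `p < q` of
the window with `S p q` at whose vertex every other index of the window is correct.  If every window has at most one tip (`hU`) and, for
fixed `i`, the `j ≤ n` admitting a tip form an interval (`hB`), then the pairs `p < q ≤ n` with `S p q` satisfying (M) «every index strictly
between is correct», (L) «the maximal run of correct indices `p-1, p-2, …` has even length» and (R) «the maximal run of correct indices
`q+1, …` inside `0..n` has even length» number at most `n`: the windows whose tip is a given such pair form a rectangle of signed area
`(-1)^(p+q) = -1` exactly when (L) and (R) hold, and the total signed area is a sum of `n + 1` row sums in `{-1, 0, 1}`, the last one `0`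
(THEOREM-T.md §2–3, val-sym-lift-p4 g14). [folklore] -/
theorem card_le_of_unique_tips (n : ℕ) (G : ℕ → ℕ → ℕ → Prop) (S : ℕ → ℕ → Prop)
    (hS : ∀ p q, S p q → Odd (p + q))
    (hU : ∀ i j p q p' q', i ≤ p → p < q → q ≤ j → S p q → (∀ t, i ≤ t → t ≤ j → t ≠ p → t ≠ q → G p q t) →
      i ≤ p' → p' < q' → q' ≤ j → S p' q' → (∀ t, i ≤ t → t ≤ j → t ≠ p' → t ≠ q' → G p' q' t) → p = p' ∧ q = q')
    (hB : ∀ i j₁ j₂ j₃, j₁ ≤ j₂ → j₂ ≤ j₃ → j₃ ≤ n →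
      (∃ p q, i ≤ p ∧ p < q ∧ q ≤ j₁ ∧ S p q ∧ ∀ t, i ≤ t → t ≤ j₁ → t ≠ p → t ≠ q → G p q t) →
      (∃ p q, i ≤ p ∧ p < q ∧ q ≤ j₃ ∧ S p q ∧ ∀ t, i ≤ t → t ≤ j₃ → t ≠ p → t ≠ q → G p q t) →
      (∃ p q, i ≤ p ∧ p < q ∧ q ≤ j₂ ∧ S p q ∧ ∀ t, i ≤ t → t ≤ j₂ → t ≠ p → t ≠ q → G p q t)) :
    (((range (n + 1)) ×ˢ (range (n + 1))).filter (fun pq : ℕ × ℕ => pq.1 < pq.2 ∧ pq.2 ≤ n ∧ S pq.1 pq.2 ∧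
        (∀ t, pq.1 < t → t < pq.2 → G pq.1 pq.2 t) ∧
        (∃ r, Even r ∧ r ≤ pq.1 ∧ (∀ t, pq.1 - r ≤ t → t < pq.1 → G pq.1 pq.2 t) ∧ (r = pq.1 ∨ ¬ G pq.1 pq.2 (pq.1 - r - 1))) ∧
        (∃ r, Even r ∧ pq.2 + r ≤ n ∧ (∀ t, pq.2 < t → t ≤ pq.2 + r → G pq.1 pq.2 t) ∧
          (pq.2 + r = n ∨ ¬ G pq.1 pq.2 (pq.2 + r + 1))))).card ≤ n := by
  -- the tip predicate and the window grid
  obtain ⟨Tip, hTip⟩ : ∃ Tip : ℕ → ℕ → ℕ × ℕ → Prop, ∀ i j pq, Tip i j pq ↔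
      (i ≤ pq.1 ∧ pq.1 < pq.2 ∧ pq.2 ≤ j ∧ S pq.1 pq.2 ∧ ∀ t, i ≤ t → t ≤ j → t ≠ pq.1 → t ≠ pq.2 → G pq.1 pq.2 t) :=
    ⟨fun i j pq => i ≤ pq.1 ∧ pq.1 < pq.2 ∧ pq.2 ≤ j ∧ S pq.1 pq.2 ∧ ∀ t, i ≤ t → t ≤ j → t ≠ pq.1 → t ≠ pq.2 → G pq.1 pq.2 t,
      fun _ _ _ => Iff.rfl⟩
  set P : Finset (ℕ × ℕ) := (range (n + 1)) ×ˢ (range (n + 1)) with hP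
  obtain ⟨Ev, hEv⟩ : ∃ Ev : Finset (ℕ × ℕ), Ev = P.filter (fun pq : ℕ × ℕ => pq.1 < pq.2 ∧ pq.2 ≤ n ∧ S pq.1 pq.2 ∧
        (∀ t, pq.1 < t → t < pq.2 → G pq.1 pq.2 t) ∧
        (∃ r, Even r ∧ r ≤ pq.1 ∧ (∀ t, pq.1 - r ≤ t → t < pq.1 → G pq.1 pq.2 t) ∧ (r = pq.1 ∨ ¬ G pq.1 pq.2 (pq.1 - r - 1))) ∧
        (∃ r, Even r ∧ pq.2 + r ≤ n ∧ (∀ t, pq.2 < t → t ≤ pq.2 + r → G pq.1 pq.2 t) ∧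
          (pq.2 + r = n ∨ ¬ G pq.1 pq.2 (pq.2 + r + 1)))) := ⟨_, rfl⟩
  rw [← hEv]
  -- the signed count of tips over the window grid
  set F : ℤ := ∑ i ∈ range (n + 1), ∑ j ∈ range (n + 1), (-1 : ℤ) ^ (i + j) * ((P.filter (Tip i j)).card : ℤ) with hF
  -- (1) rectangle identity: for each pair, the signed area of its rectangle of windows
  have hrect : ∀ pq ∈ P, ∑ i ∈ range (n + 1), ∑ j ∈ range (n + 1), (-1 : ℤ) ^ (i + j) * (if Tip i j pq then 1 else 0) =
      if pq ∈ Ev then -1 else 0 := by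
    rintro ⟨p, q⟩ hpq
    have hpn : p ≤ n := by have := (mem_product.mp hpq).1; rw [mem_range] at this; omega
    have hqn : q ≤ n := by have := (mem_product.mp hpq).2; rw [mem_range] at this; omega
    by_cases hM : p < q ∧ S p q ∧ ∀ t, p < t → t < q → G p q t
    · obtain ⟨hpq', hS', hM'⟩ := hM
      -- the tip windows of the pair form a rectangle: rows × columns
      have htip : ∀ i j, Tip i j (p, q) ↔ ((i ≤ p ∧ ∀ t, i ≤ t → t < p → G p q t) ∧ (q ≤ j ∧ ∀ t, q < t → t ≤ j → G p q t)) := by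
        intro i j
        rw [hTip]
        constructor
        · rintro ⟨hip, -, hqj, -, hall⟩
          exact ⟨⟨hip, fun t h1 h2 => hall t h1 (by omega) (by omega) (by omega)⟩,
            ⟨hqj, fun t h1 h2 => hall t (by omega) h2 (by omega) (by omega)⟩⟩
        · rintro ⟨⟨hip, hrow⟩, ⟨hqj, hcol⟩⟩
          refine ⟨hip, hpq', hqj, hS', fun t h1 h2 h3 h4 => ?_⟩
          rcases lt_trichotomy t p with ht | ht | ht
          · exact hrow t h1 ht
          · exact absurd ht h3
          · rcases lt_trichotomy t q with ht' | ht' | ht'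
            · exact hM' t ht ht'
            · exact absurd ht' h4
            · exact hcol t ht' h2
      have hrow := tipRow_altSum (fun t => G p q t) n p hpn
      have hcol := tipCol_altSum (fun t => G p q t) n q hqn
      -- factor the double sum
      have hfac : ∑ i ∈ range (n + 1), ∑ j ∈ range (n + 1), (-1 : ℤ) ^ (i + j) * (if Tip i j (p, q) then 1 else 0) =
          (∑ i ∈ (range (n + 1)).filter (fun i => i ≤ p ∧ ∀ t, i ≤ t → t < p → G p q t), (-1 : ℤ) ^ i) *
          (∑ j ∈ (range (n + 1)).filter (fun j => q ≤ j ∧ ∀ t, q < t → t ≤ j → G p q t), (-1 : ℤ) ^ j) := by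
        rw [sum_filter, sum_filter, sum_mul_sum]
        apply sum_congr rfl
        intro i _
        apply sum_congr rfl
        intro j _
        rw [htip i j]
        by_cases hi : i ≤ p ∧ ∀ t, i ≤ t → t < p → G p q t
        · by_cases hj : q ≤ j ∧ ∀ t, q < t → t ≤ j → G p q t
          · rw [if_pos ⟨hi, hj⟩, if_pos hi, if_pos hj, pow_add, mul_one]
          · rw [if_neg (fun h => hj h.2), if_neg hj, mul_zero, mul_zero]
        · rw [if_neg (fun h => hi h.1), if_neg hi, zero_mul, mul_zero]
      rw [hfac, hrow, hcol]
      have hev : (p, q) ∈ Ev ↔ ((∃ r, Even r ∧ r ≤ p ∧ (∀ t, p - r ≤ t → t < p → G p q t) ∧ (r = p ∨ ¬ G p q (p - r - 1))) ∧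
          (∃ r, Even r ∧ q + r ≤ n ∧ (∀ t, q < t → t ≤ q + r → G p q t) ∧ (q + r = n ∨ ¬ G p q (q + r + 1)))) := by
        rw [hEv, mem_filter]
        constructor
        · rintro ⟨-, -, -, -, -, hL, hR⟩
          exact ⟨hL, hR⟩
        · rintro ⟨hL, hR⟩
          exact ⟨hpq, hpq', hqn, hS', hM', hL, hR⟩
      have hodd : Odd (p + q) := hS p q hS'
      by_cases hL : ∃ r, Even r ∧ r ≤ p ∧ (∀ t, p - r ≤ t → t < p → G p q t) ∧ (r = p ∨ ¬ G p q (p - r - 1))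
      · by_cases hR : ∃ r, Even r ∧ q + r ≤ n ∧ (∀ t, q < t → t ≤ q + r → G p q t) ∧ (q + r = n ∨ ¬ G p q (q + r + 1))
        · rw [if_pos hL, if_pos hR, if_pos (hev.mpr ⟨hL, hR⟩), ← pow_add, Odd.neg_one_pow hodd]
        · rw [if_neg hR, mul_zero, if_neg (fun h => hR (hev.mp h).2)]
      · rw [if_neg hL, zero_mul, if_neg (fun h => hL (hev.mp h).1)]
    · -- no tip anywhere, and not an event
      have hnot : ∀ i j, ¬ Tip i j (p, q) := by
        intro i j h
        rw [hTip] at h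
        obtain ⟨hip, hpq', hqj, hS', hall⟩ := h
        exact hM ⟨hpq', hS', fun t h1 h2 => hall t (by omega) (by omega) (by omega) (by omega)⟩
      have hnev : (p, q) ∉ Ev := by
        rw [hEv, mem_filter]
        rintro ⟨-, h1, -, h3, h4, -⟩
        exact hM ⟨h1, h3, h4⟩
      rw [if_neg hnev]
      apply sum_eq_zero
      intro i _
      apply sum_eq_zero
      intro j _
      rw [if_neg (hnot i j), mul_zero]
  -- (2) hence `F = -|Ev|`
  have hF1 : F = -(Ev.card : ℤ) := by
    have h1 : ∀ i j, ((P.filter (Tip i j)).card : ℤ) = ∑ pq ∈ P, (if Tip i j pq then (1 : ℤ) else 0) := by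
      intro i j
      rw [card_filter]
      push_cast
      rfl
    have h2 : F = ∑ pq ∈ P, ∑ i ∈ range (n + 1), ∑ j ∈ range (n + 1), (-1 : ℤ) ^ (i + j) * (if Tip i j pq then 1 else 0) := by
      rw [hF]
      simp_rw [h1, mul_sum]
      rw [sum_congr rfl (fun i _ => sum_comm), sum_comm]
    have hsub : (P.filter fun pq => pq ∈ Ev) = Ev := by
      ext pq
      rw [mem_filter]
      constructor
      · rintro ⟨-, h⟩
        exact h
      · intro h
        refine ⟨?_, h⟩
        rw [hEv] at h
        exact mem_of_mem_filter pq h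
    rw [h2, sum_congr rfl hrect, ← sum_filter, sum_const, smul_neg, nsmul_one, hsub]
  -- (3) row by row: each window has at most one tip, and the tip columns of a row form an interval
  have hcard01 : ∀ i j, ((P.filter (Tip i j)).card : ℤ) = if (P.filter (Tip i j)).Nonempty then 1 else 0 := by
    intro i j
    have hle : (P.filter (Tip i j)).card ≤ 1 := by
      apply card_le_one.mpr
      rintro ⟨p, q⟩ hpq ⟨p', q'⟩ hpq'
      rw [mem_filter, hTip] at hpq hpq'
      obtain ⟨-, h1, h2, h3, h4, h5⟩ := hpq
      obtain ⟨-, h1', h2', h3', h4', h5'⟩ := hpq'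
      obtain ⟨rfl, rfl⟩ := hU i j p q p' q' h1 h2 h3 h4 h5 h1' h2' h3' h4' h5'
      rfl
    split_ifs with hne
    · have := hne.card_pos; omega
    · rw [not_nonempty_iff_eq_empty] at hne; rw [hne]; rfl
  have hrow : ∀ i ∈ range (n + 1), |∑ j ∈ range (n + 1), (-1 : ℤ) ^ (i + j) * ((P.filter (Tip i j)).card : ℤ)| ≤ 1 := by
    intro i _
    have h1 : ∑ j ∈ range (n + 1), (-1 : ℤ) ^ (i + j) * ((P.filter (Tip i j)).card : ℤ) =
        (-1) ^ i * ∑ j ∈ (range (n + 1)).filter (fun j => (P.filter (Tip i j)).Nonempty), (-1 : ℤ) ^ j := by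
      rw [mul_sum, sum_filter]
      apply sum_congr rfl
      intro j _
      rw [hcard01, pow_add]
      split_ifs <;> ring
    rw [h1, abs_mul, abs_pow, abs_neg, abs_one, one_pow, one_mul]
    apply abs_altSum_convex_le
    intro j₁ j₂ j₃ h12 h23 hj₁ hj₃
    rw [mem_filter, mem_range] at hj₁ hj₃ ⊢
    refine ⟨by omega, ?_⟩
    obtain ⟨⟨p₁, q₁⟩, hp₁⟩ := hj₁.2
    obtain ⟨⟨p₃, q₃⟩, hp₃⟩ := hj₃.2
    rw [mem_filter, hTip] at hp₁ hp₃
    obtain ⟨p, q, h1, h2, h3, h4, h5⟩ := hB i j₁ j₂ j₃ h12 h23 (by omega) ⟨p₁, q₁, hp₁.2⟩ ⟨p₃, q₃, hp₃.2⟩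
    refine ⟨(p, q), ?_⟩
    rw [mem_filter, hTip, hP, mem_product, mem_range, mem_range]
    exact ⟨⟨by omega, by omega⟩, h1, h2, h3, h4, h5⟩
  -- the last row is empty
  have hlast : ∑ j ∈ range (n + 1), (-1 : ℤ) ^ (n + j) * ((P.filter (Tip n j)).card : ℤ) = 0 := by
    apply sum_eq_zero
    intro j hj
    rw [mem_range] at hj
    have : P.filter (Tip n j) = ∅ := by
      apply filter_false_of_mem
      rintro ⟨p, q⟩ _ h
      rw [hTip] at h
      obtain ⟨h1, h2, h3, -, -⟩ := h
      simp only at h1 h2 h3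
      omega
    rw [this, card_empty, Nat.cast_zero, mul_zero]
  -- (4) conclusion
  have hFle : |F| ≤ n := by
    rw [hF, sum_range_succ, hlast, add_zero]
    refine (abs_sum_le_sum_abs _ _).trans ?_
    have : ∑ i ∈ range n, |∑ j ∈ range (n + 1), (-1 : ℤ) ^ (i + j) * ((P.filter (Tip i j)).card : ℤ)| ≤ ∑ _i ∈ range n, (1 : ℤ) :=
      sum_le_sum fun i hi => hrow i (by rw [mem_range] at hi ⊢; omega)
    simpa using this
  have : (Ev.card : ℤ) ≤ n := by
    have h := neg_abs_le F
    rw [hF1, abs_neg] at *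
    linarith [abs_nonneg (Ev.card : ℤ), hFle, h]
  exact_mod_cast this


end StaticPathFold

end Summit.ValiantsHypothesis.ValiantsHypothesis.Theorems.KPlusLogSqLaw
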